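import Summits.QuantumFields.QCD.Theses.HeatSlicedQuarks
import Summits.QuantumFields.YangMills.Theorems.ParabolicTrajectoryLatticeGapOnTrajectoryTransferReduction
import Literature.MathematicalPhysics.QuantumFieldTheory.MassGapTimeOrderedDetermined
import Literature.MathematicalPhysics.QuantumFieldTheory.SchwingerLimitInheritance

/-!
# Stub `stub_speciesGapTransfer` of line `low-mode-quarantine`
(crux `Summit.QuantumFields.QCD.Theses.HeatSlicedQuarks.RobustYangMillsHandover`,
item stmt-QuantumFields-8892)

**The continuum gap clause of `QCDOf` from the lattice: what transfers is the Cauchy–Schwarz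
form of clustering on the smeared species correlators.**  Let `T` be QCD along the scheme `sch`
(`IsQCDAlong sch T`: the lattice `n`-point functions of the smeared, renormalised species fields
converge to `T.schwinger` on off-diagonal real product tensors).  Suppose that for every pair of
arities `n, m ≥ 1`, every pair of species strings, every pair of FINITE FAMILIES of slab-ordered
real factor data `(pᵢ)`, `(qⱼ)` (real one-point test functions supported in positive, pairwise
ordered time slabs — the factor data of the tree's `slabOrderedProducts`) with complex
coefficients `(cᵢ)`, `(c'ⱼ)`, every time `t ≥ 0` and every `ε > 0`, EVENTUALLY along the scheme
the lattice correlators obey the transfer-matrix (spectral) form of exponential clustering,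
`|⟨F̂Ω, (e^{−tH} − |Ω⟩⟨Ω|) ĜΩ⟩| ≤ e^{−Δt} ‖F̂Ω‖ ‖ĜΩ‖ + ε` for `F = ∑ cᵢ ⊗pᵢ`, `G = ∑ c'ⱼ ⊗qⱼ`,
written out on the lattice `(n+m)`-, `n`-, `m`-, `2n`- and `2m`-point functions
(`qcdLatticeSchwinger`) of the reflected / translated factor families.  Then `T.HasMassGap Δ`:
uniform exponential clustering at rate `Δ` of ALL truncated Schwinger functions of `T` on ALL
time-ordered test functions, i.e. the full-spectrum continuum gap clause of `QCDOf`.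

This is the correctly-shaped replacement, for this line, of the shared head
`GradientFlowSpecies.GapTransfer` (stmt-8923), whose hypothesis `HasLatticeMassGap` (local
observables, per-pair constants chosen before `∀ᶠ k`, lattice times) does not pass to the limit
(standing disproof `Cruxes/RobustYangMillsHandover/Disproof.lean` §13; lead audit
`GapTransfer-AUDIT.md`): per-pair constants survive the limit only as CONTINUOUS functionals of
the test functions — here the reflection-positive norms `‖F̂Ω‖² = 𝔖₂ₙ(ΘF* ⊗ F)`, themselves
limits of lattice data — and only on the span of the real product tensors that `IsQCDAlong`
reaches.  The hypothesis is exactly what Lüscher's positive transfer matrix delivers for an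
honest lattice theory with spectral gap `Δ` in physical units (any species renormalisations
`z, shift`), up to finite-volume / `O(a_k)` time-mismatch errors that the `ε`-slack absorbs; by
the convergence `IsQCDAlong` it is EQUIVALENT to the Cauchy–Schwarz gap bound of `T` on the span
of slab-ordered real product tensors.

Proof.  (1) Degree `0` in either slot: the truncated quantity vanishes (E4 along a spatial
direction + E1).  (2) `n, m ≥ 1`, `F`, `G` in the `ℂ`-span of `slabOrderedProducts`: expand
sesquilinearly; every term is the limit of its lattice counterpart (`IsQCDAlong` on the
off-diagonal real product tensors `ΘPᵢ* ⊗ T_t Qⱼ`, `ΘPᵢ*`, `Qⱼ`, `ΘPᵢ* ⊗ Pᵢ'`), so the lattice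
inequality passes to the limit, then `ε → 0`.  (3) General time-ordered `F, G`: both sides are
continuous in `(F, G)`; ordered-wedge density `IsTimeOrdered.mem_closure_span_slabOrderedProducts`.
References: Osterwalder–Schrader 1973 §2–§4; Glimm–Jaffe 1987 §6.1, §19.7; Lüscher, CMP 54
(1977) 283; Osterwalder–Seiler 1978 §2–§4.
-/

noncomputable section

namespace Summit.QuantumFields.QCD.Cruxes.RobustYangMillsHandover.LowModeQuarantine

open scoped BigOperators SchwartzMap ComplexConjugate
open Literature.MathematicalPhysics.QuantumFieldTheory
open Literature.MathematicalPhysics.QuantumLattice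
open Literature.MathematicalPhysics.AQFT
open Summit.QuantumFields.YangMills.Cruxes.LatticeGapOnTrajectory.OrbitKantorovichFiniteSize.Transfer
  (eq_appendTensor_of_isAppendTensorOf continuous_osAdjoint_appendTensor_translateMulti
    isTensorOf_osAdjoint_appendTensor_translateMulti
    isOffDiagonal_osAdjoint_appendTensor_translateMulti_of_slabs)
open Filter Topology

variable {d : ℕ} [NeZero d] {n m : ℕ}

/-- Sesquilinear expansion of `S(Θ(∑ᵢ aᵢFᵢ)* ⊗ ∑ⱼ bⱼGⱼ)` for a linear functional `S`
(`osAdjoint` is conjugate-linear, `appendTensor` bilinear). -/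
private theorem sgt_apply_osAdjoint_appendTensor_sum_smul
    (S : 𝓢((Fin (n + m) → EuclideanSpace ℝ (Fin d)), ℂ) →L[ℂ] ℂ) {ι κ : Type*} (s : Finset ι)
    (u : Finset κ) (a : ι → ℂ) (b : κ → ℂ) (F : ι → 𝓢((Fin n → EuclideanSpace ℝ (Fin d)), ℂ))
    (G : κ → 𝓢((Fin m → EuclideanSpace ℝ (Fin d)), ℂ)) :
    S ((osAdjoint (∑ i ∈ s, a i • F i)).appendTensor (∑ j ∈ u, b j • G j)) =
      ∑ i ∈ s, ∑ j ∈ u, conj (a i) * b j * S ((osAdjoint (F i)).appendTensor (G j)) := by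
  rw [osAdjoint_sum, SchwartzMap.appendTensor_sum_left, map_sum]
  refine Finset.sum_congr rfl fun i _ => ?_
  rw [SchwartzMap.appendTensor_sum_right, map_sum]
  refine Finset.sum_congr rfl fun j _ => ?_
  rw [osAdjoint_smul, SchwartzMap.appendTensor_smul_left, SchwartzMap.appendTensor_smul_right,
    map_smul, map_smul, smul_eq_mul, smul_eq_mul]
  ring

/-- Linear expansion of `S(Θ(∑ᵢ aᵢFᵢ)*)`. -/
private theorem sgt_apply_osAdjoint_sum_smul
    (S : 𝓢((Fin n → EuclideanSpace ℝ (Fin d)), ℂ) →L[ℂ] ℂ) {ι : Type*} (s : Finset ι)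
    (a : ι → ℂ) (F : ι → 𝓢((Fin n → EuclideanSpace ℝ (Fin d)), ℂ)) :
    S (osAdjoint (∑ i ∈ s, a i • F i)) = ∑ i ∈ s, conj (a i) * S (osAdjoint (F i)) := by
  rw [osAdjoint_sum, map_sum]
  refine Finset.sum_congr rfl fun i _ => ?_
  rw [osAdjoint_smul, map_smul, smul_eq_mul]

omit [NeZero d] in
/-- Linear expansion of `S(∑ⱼ bⱼGⱼ)`. -/
private theorem sgt_apply_sum_smul
    (S : 𝓢((Fin m → EuclideanSpace ℝ (Fin d)), ℂ) →L[ℂ] ℂ) {κ : Type*} (u : Finset κ)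
    (b : κ → ℂ) (G : κ → 𝓢((Fin m → EuclideanSpace ℝ (Fin d)), ℂ)) :
    S (∑ j ∈ u, b j • G j) = ∑ j ∈ u, b j * S (G j) := by
  rw [map_sum]
  refine Finset.sum_congr rfl fun j _ => ?_
  rw [map_smul, smul_eq_mul]

omit [NeZero d] in
/-- A translate of a test function in NO variable is itself. -/
private theorem sgt_translateMulti_of_isEmpty [IsEmpty (Fin n)] (a : EuclideanSpace ℝ (Fin d))
    (F : 𝓢((Fin n → EuclideanSpace ℝ (Fin d)), ℂ)) : translateMulti a F = F := by
  ext x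
  rw [translateMulti_apply]
  exact congrArg F (Subsingleton.elim _ _)

/-- **Degree zero, left slot**: for `F` in no variable the truncated quantity of the mass-gap
clause vanishes (E4 along a spatial direction `a`, E1 for the time translate of `G`). -/
private theorem sgt_truncated_eq_zero_left {ι : Type} (T : OSData ι d) (k : Fin 0 → ι)
    (k' : Fin m → ι) (F : 𝓢((Fin 0 → EuclideanSpace ℝ (Fin d)), ℂ))
    (G : 𝓢((Fin m → EuclideanSpace ℝ (Fin d)), ℂ)) (hF : IsTimeOrdered F) (hG : IsTimeOrdered G)
    {a : EuclideanSpace ℝ (Fin d)} (ha0 : a 0 = 0) (ha : a ≠ 0) {t : ℝ} (ht : 0 ≤ t) :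
    T.schwinger (0 + m) (Fin.append (k ∘ Fin.rev) k')
        ((osAdjoint F).appendTensor (translateMulti (EuclideanSpace.single 0 t) G)) -
      T.schwinger 0 (k ∘ Fin.rev) (osAdjoint F) * T.schwinger m k' G = 0 := by
  set Gt := translateMulti (EuclideanSpace.single (0 : Fin d) t) G with hGt_def
  have hGt : IsTimeOrdered Gt :=
    OSReconstructionNoE1.isTimeOrdered_translateMulti hG (by simp [ht])
  have hX : IsOffDiagonal ((osAdjoint F).appendTensor Gt) :=
    OSReconstructionNoE1.isOffDiagonal_appendTensor_osAdjoint hF hGt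
  -- E4 along `a` for the pair `(F, Gt)`
  have hE4 := T.cluster 0 m k k' F Gt hF hGt a ha0 ha
    (fun s => (osAdjoint F).appendTensor (translateMulti (s • a) Gt))
    (fun s => isAppendTensorOf_appendTensor _ _)
  -- the E4 sequence is constant
  have hconst : ∀ s : ℝ, T.schwinger (0 + m) (Fin.append (k ∘ Fin.rev) k')
      ((osAdjoint F).appendTensor (translateMulti (s • a) Gt)) =
      T.schwinger (0 + m) (Fin.append (k ∘ Fin.rev) k') ((osAdjoint F).appendTensor Gt) := by
    intro s
    have h1 : (osAdjoint F).appendTensor (translateMulti (s • a) Gt) =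
        translateMulti (s • a) ((osAdjoint F).appendTensor Gt) := by
      rw [translateMulti_appendTensor, sgt_translateMulti_of_isEmpty (s • a) (osAdjoint F)]
    rw [h1]
    exact T.invariant.translateMulti (0 + m) _ (s • a) _ hX
  simp_rw [hconst] at hE4
  have h0 := tendsto_nhds_unique tendsto_const_nhds hE4
  -- E1 for the time translate of `G`
  have hGE1 : T.schwinger m k' Gt = T.schwinger m k' G :=
    T.invariant.translateMulti m k' _ G hG.isOffDiagonal
  rw [← hGE1]
  exact h0

/-- **Degree zero, right slot**: for `G` in no variable the truncated quantity vanishes. -/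
private theorem sgt_truncated_eq_zero_right {ι : Type} (T : OSData ι d) (k : Fin n → ι)
    (k' : Fin 0 → ι) (F : 𝓢((Fin n → EuclideanSpace ℝ (Fin d)), ℂ))
    (G : 𝓢((Fin 0 → EuclideanSpace ℝ (Fin d)), ℂ)) (hF : IsTimeOrdered F) (hG : IsTimeOrdered G)
    {a : EuclideanSpace ℝ (Fin d)} (ha0 : a 0 = 0) (ha : a ≠ 0) (t : ℝ) :
    T.schwinger (n + 0) (Fin.append (k ∘ Fin.rev) k')
        ((osAdjoint F).appendTensor (translateMulti (EuclideanSpace.single 0 t) G)) -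
      T.schwinger n (k ∘ Fin.rev) (osAdjoint F) * T.schwinger 0 k' G = 0 := by
  rw [sgt_translateMulti_of_isEmpty]
  have hE4 := T.cluster n 0 k k' F G hF hG a ha0 ha
    (fun s => (osAdjoint F).appendTensor (translateMulti (s • a) G))
    (fun s => isAppendTensorOf_appendTensor _ _)
  simp_rw [sgt_translateMulti_of_isEmpty] at hE4
  exact tendsto_nhds_unique tendsto_const_nhds hE4

/-- **stub_speciesGapTransfer — the continuum half of the handover, correctly shaped (PROVED).**
For `T` QCD along `sch` (`IsQCDAlong sch T`): if, for all arities `n, m ≥ 1`, species strings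
`σ, σ'`, finite families of slab-ordered real factor data `p : Fin N → Fin n → 𝓢(ℝ⁴, ℝ)`,
`q : Fin N' → Fin m → 𝓢(ℝ⁴, ℝ)` with coefficients `c, c'`, all `t ≥ 0` and `ε > 0`, eventually
in `k` the lattice correlators `𝔖ᵏ = qcdLatticeSchwinger sch k` satisfy the Cauchy–Schwarz
(transfer-matrix) clustering bound
`‖∑ᵢⱼ c̄ᵢ c'ⱼ (𝔖ᵏ_{n+m}(θpᵢʳ ++ T_t qⱼ) − 𝔖ᵏₙ(θpᵢʳ) 𝔖ᵏₘ(qⱼ))‖ ≤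
 e^{−Δt} √‖∑ᵢᵢ' c̄ᵢ cᵢ' 𝔖ᵏ₂ₙ(θpᵢʳ ++ pᵢ')‖ √‖∑ⱼⱼ' c̄'ⱼ c'ⱼ' 𝔖ᵏ₂ₘ(θqⱼʳ ++ qⱼ')‖ + ε`
(`θpʳ` = time-reflected factors in reversed order, `T_t` = time translation), then
`T.HasMassGap Δ`.  See the module docstring for the proof and for why this, and not
`HasLatticeMassGap`, is the lattice statement that transfers. -/
theorem stub_speciesGapTransfer :
    ∀ (Nf : ℕ) (sch : QCDScheme Nf) (T : OSData (QCDField Nf) 4) (Δ : ℝ),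
      IsQCDAlong sch T →
      (∀ (n m : ℕ), n ≠ 0 → m ≠ 0 → ∀ (σ : Fin n → QCDField Nf) (σ' : Fin m → QCDField Nf)
          (N N' : ℕ) (c : Fin N → ℂ) (c' : Fin N' → ℂ)
          (p : Fin N → Fin n → 𝓢(EuclideanSpace ℝ (Fin 4), ℝ))
          (q : Fin N' → Fin m → 𝓢(EuclideanSpace ℝ (Fin 4), ℝ)),
          (∀ i, ∃ lo hi : Fin n → ℝ, (∀ l, 0 < lo l) ∧ (∀ l, lo l ≤ hi l) ∧
              (∀ l l', l < l' → hi l < lo l') ∧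
              ∀ l, tsupport (p i l : EuclideanSpace ℝ (Fin 4) → ℝ) ⊆ {x | lo l ≤ x 0 ∧ x 0 ≤ hi l}) →
          (∀ j, ∃ lo hi : Fin m → ℝ, (∀ l, 0 < lo l) ∧ (∀ l, lo l ≤ hi l) ∧
              (∀ l l', l < l' → hi l < lo l') ∧
              ∀ l, tsupport (q j l : EuclideanSpace ℝ (Fin 4) → ℝ) ⊆ {x | lo l ≤ x 0 ∧ x 0 ≤ hi l}) →
          ∀ t : ℝ, 0 ≤ t → ∀ ε : ℝ, 0 < ε → ∀ᶠ k in atTop,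
            ‖∑ i, ∑ j, (starRingEnd ℂ) (c i) * c' j *
                (qcdLatticeSchwinger sch k (n + m) (Fin.append (σ ∘ Fin.rev) σ')
                    (Fin.append (fun l => thetaTest 4 (p i (Fin.rev l)))
                      (fun l => translateTest (EuclideanSpace.single 0 t) (q j l))) -
                  qcdLatticeSchwinger sch k n (σ ∘ Fin.rev) (fun l => thetaTest 4 (p i (Fin.rev l))) *
                    qcdLatticeSchwinger sch k m σ' (q j))‖ ≤
              Real.exp (-Δ * t) *
                  Real.sqrt ‖∑ i, ∑ i', (starRingEnd ℂ) (c i) * c i' *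
                    qcdLatticeSchwinger sch k (n + n) (Fin.append (σ ∘ Fin.rev) σ)
                      (Fin.append (fun l => thetaTest 4 (p i (Fin.rev l))) (p i'))‖ *
                  Real.sqrt ‖∑ j, ∑ j', (starRingEnd ℂ) (c' j) * c' j' *
                    qcdLatticeSchwinger sch k (m + m) (Fin.append (σ' ∘ Fin.rev) σ')
                      (Fin.append (fun l => thetaTest 4 (q j (Fin.rev l))) (q j'))‖ +
                ε) →
      T.HasMassGap Δ := by
  intro Nf sch T Δ hT hlat n m k k' F G hF hG
  -- notation
  let X : 𝓢((Fin n → EuclideanSpace ℝ (Fin 4)), ℂ) → 𝓢((Fin m → EuclideanSpace ℝ (Fin 4)), ℂ) →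
      ℝ → 𝓢((Fin (n + m) → EuclideanSpace ℝ (Fin 4)), ℂ) := fun P Q t =>
    (osAdjoint P).appendTensor (translateMulti (EuclideanSpace.single 0 t) Q)
  let Φ : 𝓢((Fin n → EuclideanSpace ℝ (Fin 4)), ℂ) → 𝓢((Fin m → EuclideanSpace ℝ (Fin 4)), ℂ) →
      ℝ → ℂ := fun P Q t =>
    T.schwinger (n + m) (Fin.append (k ∘ Fin.rev) k') (X P Q t) -
      T.schwinger n (k ∘ Fin.rev) (osAdjoint P) * T.schwinger m k' Q
  let Nn : 𝓢((Fin n → EuclideanSpace ℝ (Fin 4)), ℂ) → ℝ := fun P =>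
    Real.sqrt ‖T.schwinger (n + n) (Fin.append (k ∘ Fin.rev) k) ((osAdjoint P).appendTensor P)‖
  let Nm : 𝓢((Fin m → EuclideanSpace ℝ (Fin 4)), ℂ) → ℝ := fun Q =>
    Real.sqrt ‖T.schwinger (m + m) (Fin.append (k' ∘ Fin.rev) k') ((osAdjoint Q).appendTensor Q)‖
  refine ⟨Nn F * Nm G, fun t ht H hH => ?_⟩
  rw [eq_appendTensor_of_isAppendTensorOf hH]
  change ‖Φ F G t‖ ≤ Nn F * Nm G * Real.exp (-Δ * t)
  have hRHS : 0 ≤ Nn F * Nm G * Real.exp (-Δ * t) :=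
    mul_nonneg (mul_nonneg (Real.sqrt_nonneg _) (Real.sqrt_nonneg _)) (Real.exp_pos _).le
  -- Step 1: degree zero in either slot (spatial direction `e₁`, `d = 4 ≥ 2`)
  have ha0 : (EuclideanSpace.single (1 : Fin 4) (1 : ℝ) : EuclideanSpace ℝ (Fin 4)) 0 = 0 := by simp
  have ha : (EuclideanSpace.single (1 : Fin 4) (1 : ℝ) : EuclideanSpace ℝ (Fin 4)) ≠ 0 := fun h => by
    simpa using congrArg (fun v : EuclideanSpace ℝ (Fin 4) => v 1) h
  rcases Nat.eq_zero_or_pos n with rfl | hn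
  · have h0 : Φ F G t = 0 := sgt_truncated_eq_zero_left T k k' F G hF hG ha0 ha ht
    rw [h0, norm_zero]; exact hRHS
  rcases Nat.eq_zero_or_pos m with rfl | hm
  · have h0 : Φ F G t = 0 := sgt_truncated_eq_zero_right T k k' F G hF hG ha0 ha t
    rw [h0, norm_zero]; exact hRHS
  -- Step 2: the bound on span × span, from the lattice
  have hspan : ∀ P ∈ Submodule.span ℂ (slabOrderedProducts 4 n),
      ∀ Q ∈ Submodule.span ℂ (slabOrderedProducts 4 m),
        ‖Φ P Q t‖ ≤ Nn P * Nm Q * Real.exp (-Δ * t) := by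
    intro P hP Q hQ
    obtain ⟨N, c, g, rfl⟩ := Submodule.mem_span_set'.1 hP
    obtain ⟨N', c', g', rfl⟩ := Submodule.mem_span_set'.1 hQ
    -- factor data of the generators
    have hg : ∀ i, ∃ (f : Fin n → 𝓢(EuclideanSpace ℝ (Fin 4), ℝ)) (lo hi : Fin n → ℝ),
        IsTensorOf (g i : 𝓢((Fin n → EuclideanSpace ℝ (Fin 4)), ℂ)) (fun l => ofRealTest (f l)) ∧
          (∀ l, 0 < lo l) ∧ (∀ l, lo l ≤ hi l) ∧ (∀ l l', l < l' → hi l < lo l') ∧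
          ∀ l, tsupport (f l : EuclideanSpace ℝ (Fin 4) → ℝ) ⊆ {x | lo l ≤ x 0 ∧ x 0 ≤ hi l} :=
      fun i => (g i).2
    have hg' : ∀ j, ∃ (f : Fin m → 𝓢(EuclideanSpace ℝ (Fin 4), ℝ)) (lo hi : Fin m → ℝ),
        IsTensorOf (g' j : 𝓢((Fin m → EuclideanSpace ℝ (Fin 4)), ℂ)) (fun l => ofRealTest (f l)) ∧
          (∀ l, 0 < lo l) ∧ (∀ l, lo l ≤ hi l) ∧ (∀ l l', l < l' → hi l < lo l') ∧
          ∀ l, tsupport (f l : EuclideanSpace ℝ (Fin 4) → ℝ) ⊆ {x | lo l ≤ x 0 ∧ x 0 ≤ hi l} :=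
      fun j => (g' j).2
    choose p lo hi hpT hlo hle hord hsupp using hg
    choose q lo' hi' hqT hlo' hle' hord' hsupp' using hg'
    have hPi : ∀ i, IsTimeOrdered (g i : 𝓢((Fin n → EuclideanSpace ℝ (Fin 4)), ℂ)) := fun i =>
      IsTimeOrdered.of_mem_slabOrderedProducts (g i).2
    have hQj : ∀ j, IsTimeOrdered (g' j : 𝓢((Fin m → EuclideanSpace ℝ (Fin 4)), ℂ)) := fun j =>
      IsTimeOrdered.of_mem_slabOrderedProducts (g' j).2
    -- the lattice terms and their limits
    let A : ℕ → Fin N → Fin N' → ℂ := fun κ i j =>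
      qcdLatticeSchwinger sch κ (n + m) (Fin.append (k ∘ Fin.rev) k')
        (Fin.append (fun l => thetaTest 4 (p i (Fin.rev l)))
          (fun l => translateTest (EuclideanSpace.single 0 t) (q j l)))
    let B : ℕ → Fin N → ℂ := fun κ i =>
      qcdLatticeSchwinger sch κ n (k ∘ Fin.rev) (fun l => thetaTest 4 (p i (Fin.rev l)))
    let Cq : ℕ → Fin N' → ℂ := fun κ j => qcdLatticeSchwinger sch κ m k' (q j)
    let D : ℕ → Fin N → Fin N → ℂ := fun κ i i' =>
      qcdLatticeSchwinger sch κ (n + n) (Fin.append (k ∘ Fin.rev) k)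
        (Fin.append (fun l => thetaTest 4 (p i (Fin.rev l))) (p i'))
    let E : ℕ → Fin N' → Fin N' → ℂ := fun κ j j' =>
      qcdLatticeSchwinger sch κ (m + m) (Fin.append (k' ∘ Fin.rev) k')
        (Fin.append (fun l => thetaTest 4 (q j (Fin.rev l))) (q j'))
    have hA : ∀ i j, Tendsto (fun κ => A κ i j) atTop
        (𝓝 (T.schwinger (n + m) (Fin.append (k ∘ Fin.rev) k') (X (g i) (g' j) t))) := by
      intro i j
      refine hT.2.2 (n + m) (by omega) _ _ _ ?_ ?_
      · exact isTensorOf_osAdjoint_appendTensor_translateMulti (hpT i) (hqT j) _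
      · exact isOffDiagonal_osAdjoint_appendTensor_translateMulti_of_slabs (hpT i) (hqT j)
          (hlo i) (hlo' j) (hord i) (hord' j) (hsupp i) (hsupp' j) ht
    have hB : ∀ i, Tendsto (fun κ => B κ i) atTop
        (𝓝 (T.schwinger n (k ∘ Fin.rev) (osAdjoint (g i : 𝓢((Fin n → EuclideanSpace ℝ (Fin 4)), ℂ))))) :=
      fun i => hT.2.2 n hn.ne' _ _ _ (hpT i).osAdjoint (hPi i).isOffDiagonal.osAdjoint
    have hC : ∀ j, Tendsto (fun κ => Cq κ j) atTop
        (𝓝 (T.schwinger m k' (g' j : 𝓢((Fin m → EuclideanSpace ℝ (Fin 4)), ℂ)))) :=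
      fun j => hT.2.2 m hm.ne' _ _ _ (hqT j) (hQj j).isOffDiagonal
    have hD : ∀ i i', Tendsto (fun κ => D κ i i') atTop
        (𝓝 (T.schwinger (n + n) (Fin.append (k ∘ Fin.rev) k)
          ((osAdjoint (g i : 𝓢((Fin n → EuclideanSpace ℝ (Fin 4)), ℂ))).appendTensor (g i')))) := by
      intro i i'
      refine hT.2.2 (n + n) (by omega) _ _ _ ?_ ?_
      · have h := (hpT i).osAdjoint.appendTensor (hpT i')
        rwa [append_ofRealTest] at h
      · exact OSReconstructionNoE1.isOffDiagonal_appendTensor_osAdjoint (hPi i) (hPi i')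
    have hE : ∀ j j', Tendsto (fun κ => E κ j j') atTop
        (𝓝 (T.schwinger (m + m) (Fin.append (k' ∘ Fin.rev) k')
          ((osAdjoint (g' j : 𝓢((Fin m → EuclideanSpace ℝ (Fin 4)), ℂ))).appendTensor (g' j')))) := by
      intro j j'
      refine hT.2.2 (m + m) (by omega) _ _ _ ?_ ?_
      · have h := (hqT j).osAdjoint.appendTensor (hqT j')
        rwa [append_ofRealTest] at h
      · exact OSReconstructionNoE1.isOffDiagonal_appendTensor_osAdjoint (hQj j) (hQj j')
    -- expansions of the continuum quantities
    have hΦ : Φ (∑ i, c i • (g i : 𝓢((Fin n → EuclideanSpace ℝ (Fin 4)), ℂ)))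
        (∑ j, c' j • (g' j : 𝓢((Fin m → EuclideanSpace ℝ (Fin 4)), ℂ))) t =
        ∑ i, ∑ j, conj (c i) * c' j *
          (T.schwinger (n + m) (Fin.append (k ∘ Fin.rev) k') (X (g i) (g' j) t) -
            T.schwinger n (k ∘ Fin.rev) (osAdjoint (g i : 𝓢((Fin n → EuclideanSpace ℝ (Fin 4)), ℂ))) *
              T.schwinger m k' (g' j : 𝓢((Fin m → EuclideanSpace ℝ (Fin 4)), ℂ))) := by
      simp only [Φ, X]
      rw [map_sum, Finset.sum_congr rfl fun j _ => map_smul _ _ _,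
        sgt_apply_osAdjoint_appendTensor_sum_smul, sgt_apply_osAdjoint_sum_smul,
        sgt_apply_sum_smul, Finset.sum_mul_sum]
      rw [← Finset.sum_sub_distrib]
      refine Finset.sum_congr rfl fun i _ => ?_
      rw [← Finset.sum_sub_distrib]
      refine Finset.sum_congr rfl fun j _ => ?_
      ring
    have hNn : (Nn (∑ i, c i • (g i : 𝓢((Fin n → EuclideanSpace ℝ (Fin 4)), ℂ)))) =
        Real.sqrt ‖∑ i, ∑ i', conj (c i) * c i' *
          T.schwinger (n + n) (Fin.append (k ∘ Fin.rev) k)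
            ((osAdjoint (g i : 𝓢((Fin n → EuclideanSpace ℝ (Fin 4)), ℂ))).appendTensor (g i'))‖ := by
      simp only [Nn]
      rw [sgt_apply_osAdjoint_appendTensor_sum_smul]
    have hNm : (Nm (∑ j, c' j • (g' j : 𝓢((Fin m → EuclideanSpace ℝ (Fin 4)), ℂ)))) =
        Real.sqrt ‖∑ j, ∑ j', conj (c' j) * c' j' *
          T.schwinger (m + m) (Fin.append (k' ∘ Fin.rev) k')
            ((osAdjoint (g' j : 𝓢((Fin m → EuclideanSpace ℝ (Fin 4)), ℂ))).appendTensor (g' j'))‖ := by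
      simp only [Nm]
      rw [sgt_apply_osAdjoint_appendTensor_sum_smul]
    -- limits of the two sides of the lattice inequality
    have hL : Tendsto (fun κ => ‖∑ i, ∑ j, conj (c i) * c' j * (A κ i j - B κ i * Cq κ j)‖) atTop
        (𝓝 ‖Φ (∑ i, c i • (g i : 𝓢((Fin n → EuclideanSpace ℝ (Fin 4)), ℂ)))
          (∑ j, c' j • (g' j : 𝓢((Fin m → EuclideanSpace ℝ (Fin 4)), ℂ))) t‖) := by
      rw [hΦ]
      refine Tendsto.norm (tendsto_finsetSum _ fun i _ => tendsto_finsetSum _ fun j _ => ?_)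
      exact Tendsto.const_mul _ ((hA i j).sub ((hB i).mul (hC j)))
    have hR : Tendsto (fun κ => Real.exp (-Δ * t) *
          Real.sqrt ‖∑ i, ∑ i', conj (c i) * c i' * D κ i i'‖ *
          Real.sqrt ‖∑ j, ∑ j', conj (c' j) * c' j' * E κ j j'‖) atTop
        (𝓝 (Real.exp (-Δ * t) * Nn (∑ i, c i • (g i : 𝓢((Fin n → EuclideanSpace ℝ (Fin 4)), ℂ))) *
          Nm (∑ j, c' j • (g' j : 𝓢((Fin m → EuclideanSpace ℝ (Fin 4)), ℂ))))) := by
      rw [hNn, hNm]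
      refine (tendsto_const_nhds.mul ?_).mul ?_
      · refine (Tendsto.norm (tendsto_finsetSum _ fun i _ =>
          tendsto_finsetSum _ fun i' _ => ?_)).sqrt
        exact Tendsto.const_mul _ (hD i i')
      · refine (Tendsto.norm (tendsto_finsetSum _ fun j _ =>
          tendsto_finsetSum _ fun j' _ => ?_)).sqrt
        exact Tendsto.const_mul _ (hE j j')
    -- the lattice inequality, eventually, for every ε > 0
    have key : ∀ ε : ℝ, 0 < ε →
        ‖Φ (∑ i, c i • (g i : 𝓢((Fin n → EuclideanSpace ℝ (Fin 4)), ℂ)))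
            (∑ j, c' j • (g' j : 𝓢((Fin m → EuclideanSpace ℝ (Fin 4)), ℂ))) t‖ ≤
          Real.exp (-Δ * t) * Nn (∑ i, c i • (g i : 𝓢((Fin n → EuclideanSpace ℝ (Fin 4)), ℂ))) *
            Nm (∑ j, c' j • (g' j : 𝓢((Fin m → EuclideanSpace ℝ (Fin 4)), ℂ))) + ε := by
      intro ε hε
      have hev := hlat n m hn.ne' hm.ne' k k' N N' c c' p q
        (fun i => ⟨lo i, hi i, hlo i, hle i, hord i, hsupp i⟩)
        (fun j => ⟨lo' j, hi' j, hlo' j, hle' j, hord' j, hsupp' j⟩) t ht ε hε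
      exact le_of_tendsto_of_tendsto hL (hR.add_const ε) hev
    have hfin := le_of_forall_pos_le_add key
    calc ‖Φ (∑ i, c i • (g i : 𝓢((Fin n → EuclideanSpace ℝ (Fin 4)), ℂ)))
            (∑ j, c' j • (g' j : 𝓢((Fin m → EuclideanSpace ℝ (Fin 4)), ℂ))) t‖
        ≤ Real.exp (-Δ * t) * Nn (∑ i, c i • (g i : 𝓢((Fin n → EuclideanSpace ℝ (Fin 4)), ℂ))) *
            Nm (∑ j, c' j • (g' j : 𝓢((Fin m → EuclideanSpace ℝ (Fin 4)), ℂ))) := hfin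
      _ = _ := by ring
  -- Step 3: density (both sides are continuous in the pair)
  have hΦc : Continuous fun pq : 𝓢((Fin n → EuclideanSpace ℝ (Fin 4)), ℂ) ×
      𝓢((Fin m → EuclideanSpace ℝ (Fin 4)), ℂ) => Φ pq.1 pq.2 t := by
    refine Continuous.sub ?_ (Continuous.mul ?_ ?_)
    · exact (T.schwinger (n + m) (Fin.append (k ∘ Fin.rev) k')).continuous.comp
        (continuous_osAdjoint_appendTensor_translateMulti (EuclideanSpace.single 0 t))
    · exact (T.schwinger n (k ∘ Fin.rev)).continuous.comp
        (continuous_osAdjoint.comp continuous_fst)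
    · exact (T.schwinger m k').continuous.comp continuous_snd
  have hNnc : Continuous Nn :=
    Real.continuous_sqrt.comp (continuous_norm.comp
      ((T.schwinger (n + n) (Fin.append (k ∘ Fin.rev) k)).continuous.comp
        (continuous_appendTensor.comp (continuous_osAdjoint.prodMk continuous_id))))
  have hNmc : Continuous Nm :=
    Real.continuous_sqrt.comp (continuous_norm.comp
      ((T.schwinger (m + m) (Fin.append (k' ∘ Fin.rev) k')).continuous.comp
        (continuous_appendTensor.comp (continuous_osAdjoint.prodMk continuous_id))))
  have hclosed : IsClosed {pq : 𝓢((Fin n → EuclideanSpace ℝ (Fin 4)), ℂ) ×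
      𝓢((Fin m → EuclideanSpace ℝ (Fin 4)), ℂ) |
        ‖Φ pq.1 pq.2 t‖ ≤ Nn pq.1 * Nm pq.2 * Real.exp (-Δ * t)} :=
    isClosed_le (continuous_norm.comp hΦc)
      (((hNnc.comp continuous_fst).mul (hNmc.comp continuous_snd)).mul continuous_const)
  have hsub : ((Submodule.span ℂ (slabOrderedProducts 4 n) :
        Set 𝓢((Fin n → EuclideanSpace ℝ (Fin 4)), ℂ)) ×ˢ
      (Submodule.span ℂ (slabOrderedProducts 4 m) :
        Set 𝓢((Fin m → EuclideanSpace ℝ (Fin 4)), ℂ))) ⊆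
      {pq | ‖Φ pq.1 pq.2 t‖ ≤ Nn pq.1 * Nm pq.2 * Real.exp (-Δ * t)} :=
    fun pq hpq => hspan pq.1 hpq.1 pq.2 hpq.2
  have hmem : (F, G) ∈ closure (((Submodule.span ℂ (slabOrderedProducts 4 n) :
        Set 𝓢((Fin n → EuclideanSpace ℝ (Fin 4)), ℂ)) ×ˢ
      (Submodule.span ℂ (slabOrderedProducts 4 m) :
        Set 𝓢((Fin m → EuclideanSpace ℝ (Fin 4)), ℂ)))) := by
    rw [closure_prod_eq]
    exact ⟨hF.mem_closure_span_slabOrderedProducts, hG.mem_closure_span_slabOrderedProducts⟩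
  simpa only [Set.mem_setOf_eq] using hclosed.closure_subset_iff.2 hsub hmem

end Summit.QuantumFields.QCD.Cruxes.RobustYangMillsHandover.LowModeQuarantine

end
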